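import Summits.CriticalPhenomena.Ising3DConformalLimit.Theses.PerfectScreening
import Summits.CriticalPhenomena.Ising3DConformalLimit.Theorems.GaussianLimitNotScreened.Negative.Reformulation
import Summits.CriticalPhenomena.Ising3DConformalLimit.Theorems.MoebiusLimitExists.Negative.EtaExists
import Summits.CriticalPhenomena.Ising3DConformalLimit.Theorems.PerfectScreeningGaussianLimitNotScreenedMarkovRegression
import Summits.CriticalPhenomena.Ising3DConformalLimit.Theorems.PerfectScreeningGaussianLimitNotScreenedFormRiemannLimit
import Summits.CriticalPhenomena.Ising3DConformalLimit.Theorems.PerfectScreeningGaussianLimitNotScreenedRieszBalayageBound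
import Summits.CriticalPhenomena.Ising3DConformalLimit.Theorems.PerfectScreeningCoulombImpliesNontrivialOfIsingCapacity
import HarnessLib

/-!
# Crux `GaussianLimitNotScreened` (stmt-CriticalPhenomena-13886), line `single-layer-linear-regression`:
# the REDUCTION of the crux to its two halves in regression coordinates (conditional assembly)

THEOREM-ONLY file (line lead prover-line-stmt-CriticalPhenomena-13886-c2-0, 2026-08-16). With the planner's stubs
M `stub_markovRegression` (p128608), B `stub_formRiemannLimit` (p128664) and C `stub_rieszBalayageBound` (p128668) now
TREE THEOREMS, the line's whole provable content is landed and what remains are the two halves of the crux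
(`GaussianLimitNotScreenedNegative.crux_iff_half_and_amplitude`):

* `efficiency_lt_one` — the linear-prediction efficiency `(1−Δ)4^Δ < 1` on `(1/2,1)`;
* `delta_eq_half_of_aboveHalf` — half (I) `Δ = 1/2` from the registered OPEN stub A′
  `stub_regressionLinearisesAboveHalf` (single-layer linear regression above `Δ = 1/2`) and the landed M, B, C;
* **`aboveHalf_iff_halfOne`** (registered bookkeeping statement) — A′ is EQUIVALENT to half (I) "every non-degenerate
  Möbius-covariant Gaussian pointwise limit of `criticalCorr 3` has `Δ = 1/2`": the line re-coordinatises half (I) as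
  a linear-regression statement (mechanism: the regression of jointly Gaussian variables is linear), neither weaker
  nor stronger;
* `gaussianLimitNotScreened_of_aboveHalf_of_amplitude` — CONDITIONAL ASSEMBLY: A′ → D → crux, where D
  `stub_amplitudeAtHalf` is half (II) verbatim (the disprover's `crux_of_halves` second hypothesis);
* `amplitudeAtHalf_of_isingCapacityAxial'` and `gaussianLimitNotScreened_of_aboveHalf_of_isingCapacityAxial` — D, hence
  the crux given A′, from crux stmt-CriticalPhenomena-13885's registered open stub `stub_isingCapacityAxial` VERBATIM
  (axial Ising capacity at one exponent `s < 2`), through the landed engine `twoCurrentMeet_lower_of_capacityAt` and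
  Aizenman's criterion: so the crux hangs on exactly TWO named open lattice statements, A′ (half I) and
  `stub_isingCapacityAxial` (half II, shared with 13885).

References: J. Glimm, A. Jaffe, *Quantum Physics* (1987), Prop. 6.2.5; M. Aizenman, Commun. Math. Phys. 86 (1982);
M. Aizenman, H. Duminil-Copin, Ann. Math. 194 (2021).
-/

noncomputable section

namespace Summit.CriticalPhenomena.Ising3DConformalLimit.Cruxes.GaussianLimitNotScreened.SingleLayerLinearRegression

open MeasureTheory Filter Topology
open Literature.Probability.LatticeModels
open Summit.CriticalPhenomena.Ising3DConformalLimit.MoebiusLimitExistsNegative (delta_mem_Icc_of_covariantLimit)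
open Summit.CriticalPhenomena.Ising3DConformalLimit.GaussianLimitNotScreenedNegative (screened_iff_renorm)

/-- **The linear-prediction efficiency `(1 − Δ)·4^Δ` is `< 1` on `(1/2, 1)`.** With `s = Δ − 1/2 ∈ (0,1/2)`:
`(1−Δ)4^Δ = (1 − 2s)·e^{s·log 4} < (1 − 2s)·e^{2s} ≤ 1` (`log 4 < 2`, `1 − 2s ≤ e^{−2s}`). [folklore] -/
theorem efficiency_lt_one {Δ : ℝ} (h₁ : 1 / 2 < Δ) (h₂ : Δ < 1) : (1 - Δ) * (4:ℝ) ^ Δ < 1 := by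
  set s : ℝ := Δ - 1 / 2 with hs
  have hs0 : 0 < s := by rw [hs]; linarith
  have hs1 : 0 < 1 - 2 * s := by rw [hs]; linarith
  have hlog4 : Real.log 4 = 2 * Real.log 2 := by
    rw [show (4:ℝ) = 2 ^ 2 by norm_num, Real.log_pow]; push_cast; ring
  have hlog2 : Real.log 2 < 1 := by
    have := Real.log_two_lt_d9; linarith
  -- 4^Δ = 2 · exp (s · log 4)
  have h4 : (4:ℝ) ^ Δ = 2 * Real.exp (Real.log 4 * s) := by
    rw [Real.rpow_def_of_pos (by norm_num : (0:ℝ) < 4)]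
    have : Real.log 4 * Δ = Real.log 2 + Real.log 4 * s := by rw [hlog4, hs]; ring
    rw [this, Real.exp_add, Real.exp_log (by norm_num : (0:ℝ) < 2)]
  have hΔs : 1 - Δ = (1 - 2 * s) / 2 := by rw [hs]; ring
  rw [h4, hΔs]
  have hstep1 : Real.exp (Real.log 4 * s) < Real.exp (2 * s) := by
    apply Real.exp_lt_exp.2
    have : Real.log 4 < 2 := by rw [hlog4]; linarith
    nlinarith
  have hstep2 : (1 - 2 * s) * Real.exp (2 * s) ≤ 1 := by
    have h := Real.add_one_le_exp (-(2 * s))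
    have hpos : 0 < Real.exp (2 * s) := Real.exp_pos _
    calc (1 - 2 * s) * Real.exp (2 * s) ≤ Real.exp (-(2 * s)) * Real.exp (2 * s) := by
          apply mul_le_mul_of_nonneg_right _ hpos.le; linarith
      _ = 1 := by rw [← Real.exp_add]; simp
  calc (1 - 2 * s) / 2 * (2 * Real.exp (Real.log 4 * s))
      = (1 - 2 * s) * Real.exp (Real.log 4 * s) := by ring
    _ < (1 - 2 * s) * Real.exp (2 * s) := mul_lt_mul_of_pos_left hstep1 hs1
    _ ≤ 1 := hstep2

/-- **Half (I) from the open stub A′ and the LANDED M (p128608), B (p128664), C (p128668): a Gaussian Möbius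
limit of `criticalCorr 3` has `Δ = 1/2`.** Pure logic over the window `Δ ∈ [1/2, 3/4]` (tree) and
`efficiency_lt_one`: if `Δ > 1/2`, pick `φ` from SLR
with `ε := (1 − (1−Δ)4^Δ)/2`; the residual's `L → ∞` limit is the regression form (M), whose ratio to
`G(2n e₀)` tends to `1 − 4^Δ Q_Δ(φ) ≥ 1 − (1−Δ)4^Δ = 2ε` (B, C) while being eventually `≤ ε` — absurd. [folklore] -/
theorem delta_eq_half_of_aboveHalf
    (hA : ∀ (ρ : ℝ → ℝ) (Δ : ℝ) (S : CorrFamily 3), (∀ δ ∈ Set.Ioc (0:ℝ) 1, 0 < ρ δ) →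
      HasPointwiseScalingLimit (criticalCorr 3) ρ S → IsNondegenerateTwoPoint S →
      IsMoebiusCovariant Δ S → ¬ HasNontrivialU4 S → 1 / 2 < Δ →
      ∀ ε : ℝ, 0 < ε → ∃ (φ : E2 → ℝ) (R : ℕ), Continuous φ ∧ (∀ v : E2, (R : ℝ) ≤ ‖v‖ → φ v = 0) ∧
        ∀ᶠ n : ℕ in atTop, ∀ᶠ L : ℕ in atTop,
          msResidual n (layerBox R n) (profileCoeff φ n) L ≤
            ε * criticalTwoPoint 3 (Pi.single 0 ((2 * n : ℕ) : ℤ)))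
    {ρ : ℝ → ℝ} {Δ : ℝ} {S : CorrFamily 3} (hρ : ∀ δ ∈ Set.Ioc (0:ℝ) 1, 0 < ρ δ)
    (hlim : HasPointwiseScalingLimit (criticalCorr 3) ρ S) (hnd : IsNondegenerateTwoPoint S)
    (hMo : IsMoebiusCovariant Δ S) (hU4 : ¬ HasNontrivialU4 S) : Δ = 1 / 2 := by
  have hwin : Δ ∈ Set.Icc (1 / 2 : ℝ) (3 / 4) :=
    delta_mem_Icc_of_covariantLimit hρ hlim hnd hMo.isEuclideanInvariant.2 hMo.isScaleCovariant
  by_contra hne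
  have hlt : 1 / 2 < Δ := lt_of_le_of_ne hwin.1 (Ne.symm hne)
  have hlt1 : Δ < 1 := lt_of_le_of_lt hwin.2 (by norm_num)
  -- the gap κ = 1 − (1−Δ)4^Δ > 0
  set κ : ℝ := 1 - (1 - Δ) * (4:ℝ) ^ Δ with hκ
  have hκpos : 0 < κ := by rw [hκ]; linarith [efficiency_lt_one hlt hlt1]
  -- SLR with ε = κ/2
  obtain ⟨φ, R, hφc, hφs, hev⟩ := hA ρ Δ S hρ hlim hnd hMo hU4 hlt (κ / 2) (by linarith)
  -- abbreviations
  set G2 : ℕ → ℝ := fun n => criticalTwoPoint 3 (Pi.single 0 ((2 * n : ℕ) : ℤ)) with hG2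
  have hG2pos : ∀ n, 0 < G2 n := fun n => criticalTwoPoint_axis_pos (2 * n)
  set form : ℕ → ℝ := fun n => layerRegressionForm n (layerBox R n) (profileCoeff φ n) with hform
  -- (M): for eventually all n, form n ≤ (κ/2)·G(2n e₀)
  have hle : ∀ᶠ n : ℕ in atTop, form n ≤ κ / 2 * G2 n := by
    filter_upwards [hev] with n hn
    exact le_of_tendsto (stub_markovRegression n (layerBox R n) (profileCoeff φ n)) hn
  have hle' : ∀ᶠ n : ℕ in atTop, form n / G2 n ≤ κ / 2 := by
    filter_upwards [hle] with n hn
    rwa [div_le_iff₀ (hG2pos n)]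
  -- (B) + (C): form n / G(2n e₀) → 1 − 4^Δ Q_Δ(φ) ≥ κ > κ/2
  have hlimB := stub_formRiemannLimit ρ Δ S hρ hlim hnd hMo φ R hφc hφs
  have hQ : contQ Δ φ ≤ 1 - Δ := stub_rieszBalayageBound Δ hwin.1 hlt1 φ R hφc hφs
  have h4pos : 0 < (4:ℝ) ^ Δ := Real.rpow_pos_of_pos (by norm_num) Δ
  have hbig : κ / 2 < 1 - (4:ℝ) ^ Δ * contQ Δ φ := by
    have : (4:ℝ) ^ Δ * contQ Δ φ ≤ (4:ℝ) ^ Δ * (1 - Δ) := mul_le_mul_of_nonneg_left hQ h4pos.le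
    rw [hκ]; nlinarith
  have hgt : ∀ᶠ n : ℕ in atTop, κ / 2 < form n / G2 n := hlimB.eventually (eventually_gt_nhds hbig)
  obtain ⟨n, hn₁, hn₂⟩ := (hle'.and hgt).exists
  exact absurd hn₂ (not_lt.2 hn₁)

/-- **A′ ⟺ half (I) (kernel-checked with the LANDED M, B, C).** The registered open stub
`stub_regressionLinearisesAboveHalf` (hypothesis shape, left) is EQUIVALENT to half (I) of the crux in the disprover's formulation
(`GaussianLimitNotScreenedNegative.crux_iff_half_and_amplitude`, first conjunct): "every non-degenerate
Möbius-covariant Gaussian pointwise limit of `criticalCorr 3` has `Δ = 1/2`". `→` is `delta_eq_half_of_stubs` fed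
with the landed Markov identity (M1 + M2), Riemann limits (B1 + B2a + B2b + B2c) and balayage bound (C1 + C2);
`←` is vacuity (no limit with `Δ > 1/2` exists). So this line neither weakens nor strengthens half (I): it
re-coordinatises it as a linear-regression statement whose `Δ = 1/2` slice is a theorem. [folklore] -/
theorem aboveHalf_iff_halfOne :
    (∀ (ρ : ℝ → ℝ) (Δ : ℝ) (S : CorrFamily 3), (∀ δ ∈ Set.Ioc (0:ℝ) 1, 0 < ρ δ) →
      HasPointwiseScalingLimit (criticalCorr 3) ρ S → IsNondegenerateTwoPoint S →
      IsMoebiusCovariant Δ S → ¬ HasNontrivialU4 S → 1 / 2 < Δ →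
      ∀ ε : ℝ, 0 < ε → ∃ (φ : E2 → ℝ) (R : ℕ), Continuous φ ∧ (∀ v : E2, (R : ℝ) ≤ ‖v‖ → φ v = 0) ∧
        ∀ᶠ n : ℕ in atTop, ∀ᶠ L : ℕ in atTop,
          msResidual n (layerBox R n) (profileCoeff φ n) L ≤
            ε * criticalTwoPoint 3 (Pi.single 0 ((2 * n : ℕ) : ℤ))) ↔
    (∀ (ρ : ℝ → ℝ) (Δ : ℝ) (S : CorrFamily 3), (∀ δ ∈ Set.Ioc (0:ℝ) 1, 0 < ρ δ) →
      HasPointwiseScalingLimit (criticalCorr 3) ρ S → IsNondegenerateTwoPoint S →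
      IsMoebiusCovariant Δ S → ¬ HasNontrivialU4 S → Δ = 1 / 2) := by
  constructor
  · intro hA ρ Δ S hρ hlim hnd hMo hU4
    exact delta_eq_half_of_aboveHalf hA hρ hlim hnd hMo hU4
  · intro h ρ Δ S hρ hlim hnd hMo hU4 hlt ε _
    exact absurd (h ρ Δ S hρ hlim hnd hMo hU4) (ne_of_gt hlt)

/-- **CONDITIONAL ASSEMBLY — the crux from its two halves in regression coordinates:** A′
(`stub_regressionLinearisesAboveHalf`, open) → D (`stub_amplitudeAtHalf`, open) →
`PerfectScreening.GaussianLimitNotScreened`. Half (I) `Δ = 1/2` is `delta_eq_half_of_aboveHalf`; then perfect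
screening forces `ρ(1/m)²/m → ∞` (landed `screened_iff_renorm`), which half (II) forbids. Conditional result: both
hypotheses are registered OPEN stubs of crux stmt-CriticalPhenomena-13886 (the gate records them). [folklore] -/
theorem gaussianLimitNotScreened_of_aboveHalf_of_amplitude
    (hA : (∀ (ρ : ℝ → ℝ) (Δ : ℝ) (S : CorrFamily 3), (∀ δ ∈ Set.Ioc (0:ℝ) 1, 0 < ρ δ) →
      HasPointwiseScalingLimit (criticalCorr 3) ρ S → IsNondegenerateTwoPoint S →
      IsMoebiusCovariant Δ S → ¬ HasNontrivialU4 S → 1 / 2 < Δ →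
      ∀ ε : ℝ, 0 < ε → ∃ (φ : E2 → ℝ) (R : ℕ), Continuous φ ∧ (∀ v : E2, (R : ℝ) ≤ ‖v‖ → φ v = 0) ∧
        ∀ᶠ n : ℕ in atTop, ∀ᶠ L : ℕ in atTop,
          msResidual n (layerBox R n) (profileCoeff φ n) L ≤
            ε * criticalTwoPoint 3 (Pi.single 0 ((2 * n : ℕ) : ℤ))))
    (hD : (∀ (ρ : ℝ → ℝ) (S : CorrFamily 3), (∀ δ ∈ Set.Ioc (0:ℝ) 1, 0 < ρ δ) →
      HasPointwiseScalingLimit (criticalCorr 3) ρ S → IsNondegenerateTwoPoint S →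
      IsMoebiusCovariant (1/2) S → ¬ HasNontrivialU4 S →
      ¬ Tendsto (fun m : ℕ => ρ (1 / m) ^ 2 / m) atTop atTop)) :
    Summit.CriticalPhenomena.Ising3DConformalLimit.Theses.PerfectScreening.GaussianLimitNotScreened := by
  intro ρ Δ S hρ hlim hnd hMo hU4 hscr
  have hΔ : Δ = 1 / 2 := delta_eq_half_of_aboveHalf hA hρ hlim hnd hMo hU4
  subst hΔ
  exact hD ρ S hρ hlim hnd hMo hU4 ((screened_iff_renorm hlim hnd).1 hscr)

section Axial

open Summit.CriticalPhenomena.Ising3DConformalLimit.Cruxes.IsingEuclidUpgradeR4NonGaussian.FreeCovarianceDeltaDichotomy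
  (lat boxG ScaleCovariantOn hasNontrivialU4_of_twoCurrentMeet_lower)
open Summit.CriticalPhenomena.Ising3DConformalLimit.Cruxes.GaussianLimitNotScreened.KaramataAmplitudeBlindMerging
  (IsSpreadDefect defectG scaleCovariantOn_of_isMoebiusCovariant)
open Summit.CriticalPhenomena.Ising3DConformalLimit.Cruxes.CoulombImpliesNontrivial.MergingIsExpectedScreening
  (twoCurrentMeet_lower_of_capacityAt)

/-- **D ⟸ the AXIAL Ising capacity at ONE exponent `s < 2`** (found by the lead-c2 probe of stub D; primed
name to leave the skeleton's anchor untouched): the hypothesis is crux stmt-CriticalPhenomena-13885's registered open stub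
`stub_isingCapacityAxial` VERBATIM (implied by karamata's `stub_isingCapacity` through the landed
`isingCapacityAxial_of_isingCapacity`), fed at `Δ = 1/2` (`3 − 2Δ = 2 > s`) into the landed engine
`twoCurrentMeet_lower_of_capacityAt` at the axial quadruple `0, e₀, 2e₀, 3e₀` and Aizenman's criterion
`hasNontrivialU4_of_twoCurrentMeet_lower`. So half (II) of this crux and crux 13885 hang on ONE open lattice
statement. [cite: Aizenman1982, §1] -/
theorem amplitudeAtHalf_of_isingCapacityAxial'
    (hcap : ∃ s : ℝ, 0 < s ∧ s < 2 ∧ ∀ K lam nu : ℝ, 0 < K → 0 < lam → 0 < nu →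
      ∃ c' : ℝ, 0 < c' ∧ c' ≤ 1 ∧ ∃ R₀ : ℝ, ∀ c e : Site 3, (∀ j : Fin 3, j ≠ 0 → e j = c j) →
        R₀ ≤ ‖c - e‖ → ∀ᶠ L : ℕ in atTop, ∀ C : Finset (Site 3), c ∉ C → e ∉ C →
          IsSpreadDefect s K lam nu c e C → defectG L C c e ≤ (1 - c') * boxG L c e) :
    ∀ (ρ : ℝ → ℝ) (S : CorrFamily 3), (∀ δ ∈ Set.Ioc (0:ℝ) 1, 0 < ρ δ) →
      HasPointwiseScalingLimit (criticalCorr 3) ρ S → IsNondegenerateTwoPoint S →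
      IsMoebiusCovariant (1/2) S → ¬ HasNontrivialU4 S →
      ¬ Tendsto (fun m : ℕ => ρ (1 / m) ^ 2 / m) atTop atTop := by
  intro ρ S hρ hlim hnd hMo hU4 _
  obtain ⟨s, hs₀, hs₂, hcap⟩ := hcap
  have hcov : ScaleCovariantOn (1 / 2) S := scaleCovariantOn_of_isMoebiusCovariant hMo
  -- the collinear axial reference quadruple `0, e₀, 2e₀, 3e₀`
  have hx : (fun i : Fin 4 => ((i : ℕ) : ℝ) • EuclideanSpace.single (0 : Fin 3) (1:ℝ)) ∈
      NonCoincident 3 4 := by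
    intro i j hij
    have he : (EuclideanSpace.single (0 : Fin 3) (1:ℝ)) ≠ 0 := by
      intro h
      have := congrArg (fun v : EuclideanSpace ℝ (Fin 3) => v 0) h
      simp at this
    have h := smul_left_injective ℝ he hij
    have h' : (i : ℕ) = (j : ℕ) := by exact_mod_cast h
    exact Fin.ext h'
  -- its screened pair `[2e₀/δ], [3e₀/δ]` is axial
  have hax : ∀ (δ : ℝ) (j : Fin 3), j ≠ 0 →
      lat δ (fun i : Fin 4 => ((i : ℕ) : ℝ) • EuclideanSpace.single (0 : Fin 3) (1:ℝ)) 3 j =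
        lat δ (fun i : Fin 4 => ((i : ℕ) : ℝ) • EuclideanSpace.single (0 : Fin 3) (1:ℝ)) 2 j := by
    intro δ j hj
    fin_cases j
    · exact absurd rfl hj
    · simp [lat, latticeApprox_apply]
    · simp [lat, latticeApprox_apply]
  obtain ⟨κ, hκ, hev⟩ :=
    twoCurrentMeet_lower_of_capacityAt hs₀ hcap hρ hlim hnd hcov (by linarith) hx hax
  exact hU4 (hasNontrivialU4_of_twoCurrentMeet_lower hlim hnd hx hκ hev)

/-- **The crux from exactly TWO named open lattice statements**: A′ (`stub_regressionLinearisesAboveHalf` of this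
crux — half (I) in regression coordinates) and crux stmt-CriticalPhenomena-13885's registered
`stub_isingCapacityAxial` (axial Ising capacity at one exponent `s < 2` — half (II) through Aizenman's criterion).
Conditional result on both. [cite: Aizenman1982, §1] -/
theorem gaussianLimitNotScreened_of_aboveHalf_of_isingCapacityAxial
    (hA : (∀ (ρ : ℝ → ℝ) (Δ : ℝ) (S : CorrFamily 3), (∀ δ ∈ Set.Ioc (0:ℝ) 1, 0 < ρ δ) →
      HasPointwiseScalingLimit (criticalCorr 3) ρ S → IsNondegenerateTwoPoint S →
      IsMoebiusCovariant Δ S → ¬ HasNontrivialU4 S → 1 / 2 < Δ →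
      ∀ ε : ℝ, 0 < ε → ∃ (φ : E2 → ℝ) (R : ℕ), Continuous φ ∧ (∀ v : E2, (R : ℝ) ≤ ‖v‖ → φ v = 0) ∧
        ∀ᶠ n : ℕ in atTop, ∀ᶠ L : ℕ in atTop,
          msResidual n (layerBox R n) (profileCoeff φ n) L ≤
            ε * criticalTwoPoint 3 (Pi.single 0 ((2 * n : ℕ) : ℤ))))
    (hcap : (∃ s : ℝ, 0 < s ∧ s < 2 ∧ ∀ K lam nu : ℝ, 0 < K → 0 < lam → 0 < nu →
      ∃ c' : ℝ, 0 < c' ∧ c' ≤ 1 ∧ ∃ R₀ : ℝ, ∀ c e : Site 3, (∀ j : Fin 3, j ≠ 0 → e j = c j) →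
        R₀ ≤ ‖c - e‖ → ∀ᶠ L : ℕ in atTop, ∀ C : Finset (Site 3), c ∉ C → e ∉ C →
          IsSpreadDefect s K lam nu c e C → defectG L C c e ≤ (1 - c') * boxG L c e)) :
    Summit.CriticalPhenomena.Ising3DConformalLimit.Theses.PerfectScreening.GaussianLimitNotScreened :=
  gaussianLimitNotScreened_of_aboveHalf_of_amplitude hA (amplitudeAtHalf_of_isingCapacityAxial' hcap)

end Axial

end Summit.CriticalPhenomena.Ising3DConformalLimit.Cruxes.GaussianLimitNotScreened.SingleLayerLinearRegression

end
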